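import Literature.AlgebraicGeometry.Frobenioids.GeometricFrobenioidModel
import Literature.AlgebraicGeometry.Frobenioids.ModelFrobenioidMap
import Literature.AlgebraicGeometry.Frobenioids.PadicFrobenioidGoodLocalKit
import Mathlib.FieldTheory.SeparableDegree
import HarnessLib

/-!
# Frobenioids I, Theorem 6.2 (Geometric Frobenioids) — sub-DAG statements (W5): the residue of (i)

Mochizuki, *The geometry of Frobenioids I: the general theory*, Kyushu J. Math. **62** (2008) 293–400, §6,
Theorem 6.2, kurims text pp. 110–112 [cite: MochizukiFrdI2008, Thm. 6.2 p.110]. Statements-first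
companion (D-0068) of the cell's sub-DAG `SUBDAG-FrdI-Thm62` (holder abc-iut-L1-t3): the typed theorem is
`GeometricFrobenioids.lean` v4 (`Thm62i`–`Thm62iv`, SCHEMAS over the interface `GeometricDivisorData` and the
model `GeometricModelFrobenioid`); (ii) and (iv) are discharged in the tree (`Thm62ii_holds`,
`Thm62i_frobenius_holds`, `Thm62iv_holds`, abc-iut-L6-t10), (iii) is cut by the Thm. 6.4 sub-DAG
(`MotivatingExamplesSub.lean` §C). What remains is **(i) for a general dominant morphism `ψ : V₂ → V₁`**
(statement p. 110 l. 44 – p. 111 l. 4: "`ψ` induces a functor `Ψ : C₁ → C₂` [well-defined up to isomorphism]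
that is compatible with Frobenius degrees, the functor `D₁ → D₂` induced by the inclusion of fields `K₁ ↪ K₂`,
and the natural transformations `Φ₁ → Φ₂|_{D₁}`, `B₁ → B₂|_{D₁}` induced by pulling back divisors and rational
functions, respectively, via `ψ`"; proof p. 111 l. 26–35).

The printed proof has three steps; each is one row:
* **(α) T62i/L02** (p. 111 l. 26–29) "by assumptions (b), (c) … any finite extension `L₁ ⊆ K̃₁` of `K₁` determines
  a finite extension `L₂ := L₁ · K₂ ⊆ K̃₂` of `K₂` such that `[L₂ : K₂] = [L₁ : K₁]`. Thus, `ψ` determines a functor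
  `D₁ → D₂`" — the CLASSICAL field-theoretic input (linear disjointness of a finite separable extension from an
  extension in which the base is separably closed): `T62i_L02_compositumDegree`, Mathlib-level, OPEN;
* **(β) T62i/L01** (l. 29–33) "by pulling back [Cartier] divisors and rational functions via `ψ`, we obtain
  compatible natural transformations `Φ₁ → Φ₂|_{D₁}`, `B₁ → B₂|_{D₁}`" — DATA: a morphism of model data OVER the
  base functor (abc-iut-L1-t5's `ModelFrobenioid.DataHom` into abc-iut-L1-t4's restricted data `divBRestrict`;
  packaged by abc-iut-w5-d048 as `PullbackDatum`); its derivation from the scheme morphism is the FOUNDATIONS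
  boundary (proper normal varieties are not in Mathlib);
* **(γ) T62i/L03** (l. 33–35) "it follows formally from the definition of the category underlying a model
  Frobenioid in Theorem 5.2, (i), that we obtain a functor `Ψ : C₁ → C₂`" — GENERIC and CONSTRUCTED
  (`DataHom.functor ⋙ ModelFrobenioid.baseChange`, abc-iut-w5-d048 `GeometricFrobenioidThm62iFunctor.lean`);
and the node **T62i/L04** `Thm62i_of_pullbackDatum`: abc-iut-L1-t3's schema `Thm62i` at THE constructed models
(abc-iut-L6-t10's `geomModelFrobenioid`) for EVERY pull-back datum — discharged by abc-iut-w5-d048's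
`PullbackDatum.Thm62i_holds` (the one-line `_holds` binding follows its landing).
`Prop`-valued named statements only (no `sorry`, nothing asserted); nothing here bears on [IUTchIII] or takes a
side on abc.
-/

noncomputable section

namespace Literature.AlgebraicGeometry.Frobenioids

open CategoryTheory Opposite

/-! ### T62i/L02 (step (α)): the compositum functor `L₁ ↦ L₁ · K₂` has `[L₁ · K₂ : K₂] = [L₁ : K₁]` -/

/-- **T62i/L02 — "by assumptions (b), (c) … `L₂ := L₁ · K₂` … `[L₂ : K₂] = [L₁ : K₁]`"** (Thm. 6.2 (i), proof
p. 111 l. 26–29; (c) = "`K₁` is separably closed in `K₂`"): CLASSICAL field theory, stated over Mathlib — for a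
tower `K₁ → K₂ → Ω` and a finite separable subextension `L₁ ⊆ Ω` of `K₁` (inside a common overfield `Ω`, e.g.
`K̃₂`), if every element of `K₂` separable algebraic over `K₁` lies in `K₁`, then the compositum `K₂(L₁) ⊆ Ω` has
`[K₂(L₁) : K₂] = [L₁ : K₁]` (linear disjointness; the minimal polynomial over `K₁` of a primitive element of `L₁`
stays irreducible over `K₂`, its monic factors having coefficients separable algebraic over `K₁`). Not in
Mathlib in this form (`IntermediateField.LinearDisjoint` covers the algebraic and the purely inseparable cases).
[cite: MochizukiFrdI2008, Thm. 6.2 (i) p.111] -/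
def T62i_L02_compositumDegree : Prop :=
  ∀ (K₁ K₂ Ω : Type) [Field K₁] [Field K₂] [Field Ω] [Algebra K₁ K₂] [Algebra K₂ Ω] [Algebra K₁ Ω]
    [IsScalarTower K₁ K₂ Ω] (L₁ : IntermediateField K₁ Ω) [FiniteDimensional K₁ L₁] [Algebra.IsSeparable K₁ L₁],
    (∀ x : K₂, IsSeparable K₁ x → x ∈ Set.range (algebraMap K₁ K₂)) →
      Module.finrank K₂ (IntermediateField.adjoin K₂ (L₁ : Set Ω)) = Module.finrank K₁ L₁

/-! ### T62i/L04: Theorem 6.2 (i) at THE constructed models, for every pull-back datum -/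

/-- **T62i/L04 — Theorem 6.2 (i) at THE models** (the node of the sub-DAG): for geometric divisor data `Γ₁`, `Γ₂`,
a base functor `βψ : D₁ → D₂` ("`L₁ ↦ L₁ · K₂`") and a pull-back datum over it — compatible natural
transformations `Φ₁ → Φ₂|_{D₁}`, `B₁ → B₂|_{D₁}` of the model data of Ex. 6.1 (abc-iut-L1-t5's
`ModelFrobenioid.DataHom` into abc-iut-L1-t4's `divBRestrict βψ`; = abc-iut-w5-d048's `PullbackDatum Γ₁ Γ₂ βψ`)
— "`ψ` induces a functor `Ψ : C₁ → C₂` … compatible with Frobenius degrees, the functor `D₁ → D₂` …, and the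
natural transformations `Φ₁ → Φ₂|_{D₁}` …": abc-iut-L1-t3's schema `Thm62i` holds for THE model Frobenioids
`geomModelFrobenioid Γ_i` (abc-iut-L6-t10) with `φψ :=` the divisor component of the datum. DISCHARGED by
abc-iut-w5-d048's `GeometricDivisorData.PullbackDatum.Thm62i_holds` (`GeometricFrobenioidThm62iFunctor.lean`).
[cite: MochizukiFrdI2008, Thm. 6.2 (i) p.110] -/
def Thm62i_of_pullbackDatum : Prop :=
  ∀ (K₁ : Type) [Field K₁] (Kt₁ : Type) [Field Kt₁] [Algebra K₁ Kt₁]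
    (K₂ : Type) [Field K₂] (Kt₂ : Type) [Field Kt₂] [Algebra K₂ Kt₂] [IsGalois K₂ Kt₂]
    (Γ₁ : GeometricDivisorData K₁ Kt₁) (Γ₂ : GeometricDivisorData K₂ Kt₂)
    (βψ : FinSubextCat K₁ Kt₁ ⥤ FinSubextCat K₂ Kt₂)
    (h : ModelFrobenioid.DataHom (geomDivNatTrans Γ₁)
      (ModelFrobenioid.divBRestrict βψ (geomDivisorFunctor Γ₂) (geomUnitsFunctor Γ₂) (geomDivNatTrans Γ₂))),
    Thm62i (geomModelFrobenioid Γ₁) (geomModelFrobenioid Γ₂) βψ (fun X => (h.η.app (op X)).hom)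

end Literature.AlgebraicGeometry.Frobenioids

end
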